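import Summits.AtomisticToContinuum.Crystallization.Theorems.FreeSplittingCertificatesStrictSplittingRuleFarPencilFlux4Integral

/-!
# `StrictSplittingRule` (stmt-AtomisticToContinuum-12560): `∫ div Φ = 0` and `∫ N ≤ t·∫ Den` for the GENERIC far flux along compactly supported fields

Route `FreeSplittingCertificates`, crux r3 `StrictSplittingRule` (H12⋆ = `stub_coreJointCoercive`), unit b2b-freesplit-B gen 18.
VALUE = the test-field form of the inflated far lemma: the analogue of `farPencil_integral_le` (`…FarPencilIntegral`, gen 10, the `17/200` pencil)
for the generic flux `fpFlux4 a b c n = aΦ₁ + bΦ₂ + cΦ₃ + nΨ₁` and ANY pointwise certificate `N(f_S,f_A,D,C) + div Φ ≤ t·Den` — in particular for the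
inflated certificate D (`t = 9/40`) the H12⋆ assembly cites (HOME CERT.md §23/§24).  NOT a proof of H12⋆, NOT summit progress.

For every `C²` field `v : ℝ³ → ℝ³` with compact support not containing the reference site `0`:
* `integral_fpFlux4Deriv_eq_zero`: `∫ ∂ⱼΦⱼ = 0` (Mathlib's integration by parts for line derivatives against `1`);
* `integral_fpDivFlux4_eq_zero`: **`∫ fpDivFlux4 a b c n x (v x) (∇v x) dx = 0`**;
* **`farPencil4_integral_le`**: `∫ N(f_S,f_A,D,C)(x, v, ∇v) ≤ t·∫ Den(x, ∇v)` given the pointwise certificate;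
  `farPencilD_integral_le`: `∫ N(7/4,7/4,6/5,9/10) ≤ (9/40)·∫ Den`.
HONEST FRAMING: statements about continuum TEST FIELDS; NOT a proof of H12⋆, NOT summit progress.
-/

noncomputable section

open MeasureTheory Topology Filter

namespace Summit.AtomisticToContinuum.Crystallization.Theorems.StrictSplittingRuleBirth

variable {v : (Fin 3 → ℝ) → (Fin 3 → ℝ)}

/-! ## Vanishing off the support -/

/-- `Φⱼ = 0` off the support of `v` (generic flux). -/
theorem fpFlux4_eq_zero_of_notMem (a b c n : ℝ) {y : Fin 3 → ℝ} (hy : y ∉ tsupport v) (j : Fin 3) :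
    fpFlux4 a b c n v y j = 0 :=
  fpFlux4_eq_zero a b c n (fp_v_eq_zero hy) (fp_fderiv_eq_zero hy) j

/-- `∂ₖΦⱼ = 0` off the support of `v` (generic flux). -/
theorem fpFlux4Deriv_eq_zero_of_notMem (a b c n : ℝ) {y : Fin 3 → ℝ} (hy : y ∉ tsupport v) (j k : Fin 3) :
    fpFlux4Deriv a b c n v y j k = 0 :=
  fpFlux4Deriv_eq_zero a b c n (fp_v_eq_zero hy) (fp_fderiv_eq_zero hy) (fp_fderiv_fderiv_eq_zero hy) j k

/-- The inflated demand density vanishes off the support of `v`. -/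
theorem fpNumI_eq_zero_of_notMem (fS fA D C : ℝ) {y : Fin 3 → ℝ} (hy : y ∉ tsupport v) :
    fpNumI fS fA D C y (v y) (fpGrad v y) = 0 := by
  simp [fpNumI, fpGrad, fpFrob, fpSymSq, fpDot, fp_v_eq_zero hy, fp_fderiv_eq_zero hy]

/-- `fpDivFlux4` vanishes off the support of `v`. -/
theorem fpDivFlux4_eq_zero_of_notMem (a b c n : ℝ) {y : Fin 3 → ℝ} (hy : y ∉ tsupport v) :
    fpDivFlux4 a b c n y (v y) (fpGrad v y) = 0 := by
  simp [fpDivFlux4, fpGrad, fpTr, fpTrSq, fpXGV, fpVGX, fpDot, fp_v_eq_zero hy, fp_fderiv_eq_zero hy]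

/-! ## Line derivatives everywhere, integrability -/

/-- `∂ₖΦⱼ = fpFlux4Deriv` at EVERY point, for a `C²` field whose support misses `0`. -/
theorem hasLineDerivAt_fpFlux4_all (a b c n : ℝ) (hv : ContDiff ℝ 2 v) (h0 : (0 : Fin 3 → ℝ) ∉ tsupport v) (j k : Fin 3)
    (y : Fin 3 → ℝ) : HasLineDerivAt ℝ (fun z => fpFlux4 a b c n v z j) (fpFlux4Deriv a b c n v y j k) y (fpE k) := by
  by_cases hy : y ∈ tsupport v
  · have hy0 : y ≠ 0 := fp_zero_notMem_tsupport h0 hy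
    have h1 : ContDiff ℝ 1 (fderiv ℝ v) := hv.fderiv_right (by norm_num)
    exact hasLineDerivAt_fpFlux4 a b c n hy0 (hv.differentiable (by simp) y) (h1.differentiable (by simp) y) j k
  · have hev : (fun z => fpFlux4 a b c n v z j) =ᶠ[𝓝 y] fun _ => (0 : ℝ) :=
      Filter.eventually_of_mem ((isClosed_tsupport v).isOpen_compl.mem_nhds hy)
        fun z hz => fpFlux4_eq_zero_of_notMem a b c n hz j
    rw [fpFlux4Deriv_eq_zero_of_notMem a b c n hy, hev.hasLineDerivAt_iff]
    show HasDerivAt (fun _ : ℝ => (0 : ℝ)) 0 0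
    exact hasDerivAt_const _ _

section integ
variable (a b c n : ℝ) (hv : ContDiff ℝ 2 v) (hc : HasCompactSupport v) (h0 : (0 : Fin 3 → ℝ) ∉ tsupport v)
include hv hc h0

/-- `Φⱼ` is integrable (continuous with compact support). -/
theorem integrable_fpFlux4 (j : Fin 3) : Integrable fun y => fpFlux4 a b c n v y j :=
  fp_integrable hc (fun _ hy => continuousAt_fpFlux4 a b c n hv (fp_zero_notMem_tsupport h0 hy) j)
    (fun _ hy => fpFlux4_eq_zero_of_notMem a b c n hy j)

/-- `∂ₖΦⱼ` is integrable (continuous with compact support). -/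
theorem integrable_fpFlux4Deriv (j k : Fin 3) : Integrable fun y => fpFlux4Deriv a b c n v y j k :=
  fp_integrable hc (fun _ hy => continuousAt_fpFlux4Deriv a b c n hv (fp_zero_notMem_tsupport h0 hy) j k)
    (fun _ hy => fpFlux4Deriv_eq_zero_of_notMem a b c n hy j k)

omit a b c n in
/-- The inflated demand density along the field is integrable. -/
theorem integrable_fpNumI (fS fA D C : ℝ) : Integrable fun y => fpNumI fS fA D C y (v y) (fpGrad v y) :=
  fp_integrable hc (fun _ hy => continuousAt_fpNumI hv (fp_zero_notMem_tsupport h0 hy) fS fA D C)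
    (fun _ hy => fpNumI_eq_zero_of_notMem fS fA D C hy)

/-- **`∫ ∂ⱼΦⱼ = 0`** for the generic flux — integration by parts for line derivatives against the constant function `1`. -/
theorem integral_fpFlux4Deriv_eq_zero (j : Fin 3) : ∫ y, fpFlux4Deriv a b c n v y j j = 0 := by
  have hF := integrable_fpFlux4 a b c n hv hc h0 j
  have hF' := integrable_fpFlux4Deriv a b c n hv hc h0 j j
  have h := integral_bilinear_hasLineDerivAt_right_eq_neg_left_of_integrable
    (μ := (volume : Measure (Fin 3 → ℝ))) (B := ContinuousLinearMap.mul ℝ ℝ) (v := fpE j)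
    (f := fun z => fpFlux4 a b c n v z j) (f' := fun y => fpFlux4Deriv a b c n v y j j)
    (g := fun _ => (1 : ℝ)) (g' := fun _ => (0 : ℝ))
    (by simpa using hF') (by simp) (by simpa using hF)
    (fun y _ => hasLineDerivAt_fpFlux4_all a b c n hv h0 j j y)
    (fun y _ => by
      show HasDerivAt (fun _ : ℝ => (1 : ℝ)) 0 0
      exact hasDerivAt_const _ _)
  simpa using h

omit hc in
/-- `div Φ = fpDivFlux4` pointwise along the field (everywhere). -/
theorem fpDivFlux4_eq_sum_fpFlux4Deriv (y : Fin 3 → ℝ) :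
    fpDivFlux4 a b c n y (v y) (fpGrad v y) =
      fpFlux4Deriv a b c n v y 0 0 + fpFlux4Deriv a b c n v y 1 1 + fpFlux4Deriv a b c n v y 2 2 := by
  by_cases hy : y ∈ tsupport v
  · exact (sum_fpFlux4Deriv_eq_fpDivFlux4_of_contDiffAt a b c n v (fp_zero_notMem_tsupport h0 hy) hv.contDiffAt).symm
  · rw [fpDivFlux4_eq_zero_of_notMem a b c n hy, fpFlux4Deriv_eq_zero_of_notMem a b c n hy,
      fpFlux4Deriv_eq_zero_of_notMem a b c n hy, fpFlux4Deriv_eq_zero_of_notMem a b c n hy]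
    ring

/-- `fpDivFlux4` along the field is integrable. -/
theorem integrable_fpDivFlux4 : Integrable fun y => fpDivFlux4 a b c n y (v y) (fpGrad v y) := by
  have h : (fun y => fpDivFlux4 a b c n y (v y) (fpGrad v y)) =
      fun y => fpFlux4Deriv a b c n v y 0 0 + fpFlux4Deriv a b c n v y 1 1 + fpFlux4Deriv a b c n v y 2 2 :=
    funext (fpDivFlux4_eq_sum_fpFlux4Deriv a b c n hv h0)
  rw [h]
  exact ((integrable_fpFlux4Deriv a b c n hv hc h0 0 0).add (integrable_fpFlux4Deriv a b c n hv hc h0 1 1)).add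
    (integrable_fpFlux4Deriv a b c n hv hc h0 2 2)

/-- **`∫ div Φ = 0`** for the generic flux along every compactly supported `C²` field vanishing near the reference site. -/
theorem integral_fpDivFlux4_eq_zero : ∫ y, fpDivFlux4 a b c n y (v y) (fpGrad v y) = 0 := by
  have h : (fun y => fpDivFlux4 a b c n y (v y) (fpGrad v y)) =
      fun y => fpFlux4Deriv a b c n v y 0 0 + fpFlux4Deriv a b c n v y 1 1 + fpFlux4Deriv a b c n v y 2 2 :=
    funext (fpDivFlux4_eq_sum_fpFlux4Deriv a b c n hv h0)
  have i0 := integrable_fpFlux4Deriv a b c n hv hc h0 0 0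
  have i1 := integrable_fpFlux4Deriv a b c n hv hc h0 1 1
  have i2 := integrable_fpFlux4Deriv a b c n hv hc h0 2 2
  have e1 : ∫ y, (fpFlux4Deriv a b c n v y 0 0 + fpFlux4Deriv a b c n v y 1 1 + fpFlux4Deriv a b c n v y 2 2) =
      (∫ y, (fpFlux4Deriv a b c n v y 0 0 + fpFlux4Deriv a b c n v y 1 1)) + ∫ y, fpFlux4Deriv a b c n v y 2 2 :=
    integral_add (i0.add i1) i2
  have e2 : ∫ y, (fpFlux4Deriv a b c n v y 0 0 + fpFlux4Deriv a b c n v y 1 1) =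
      (∫ y, fpFlux4Deriv a b c n v y 0 0) + ∫ y, fpFlux4Deriv a b c n v y 1 1 := integral_add i0 i1
  rw [h, e1, e2, integral_fpFlux4Deriv_eq_zero a b c n hv hc h0 0, integral_fpFlux4Deriv_eq_zero a b c n hv hc h0 1,
    integral_fpFlux4Deriv_eq_zero a b c n hv hc h0 2]
  ring

end integ

/-! ## The generic far pencil for test fields -/

/-- **THE INFLATED FAR PENCIL FOR TEST FIELDS.**  Let `N(f_S,f_A,D,C) + div(aΦ₁ + bΦ₂ + cΦ₃ + nΨ₁) ≤ t·Den` hold at every `x ≠ 0`.  For every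
`C²` vector field `v : ℝ³ → ℝ³` with compact support not containing `0`:  `∫ N(x, v, ∇v) ≤ t·∫ Den(x, ∇v)`.
NOT a proof of H12⋆, NOT summit progress. -/
theorem farPencil4_integral_le {fS fA D C a b c n t : ℝ}
    (hcert : ∀ (x v : Fin 3 → ℝ) (G : Fin 3 → Fin 3 → ℝ), x ≠ 0 → fpNumI fS fA D C x v G + fpDivFlux4 a b c n x v G ≤ t * fpDen x G)
    (hv : ContDiff ℝ 2 v) (hc : HasCompactSupport v) (h0 : (0 : Fin 3 → ℝ) ∉ tsupport v) :
    ∫ x, fpNumI fS fA D C x (v x) (fpGrad v x) ≤ t * ∫ x, fpDen x (fpGrad v x) := by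
  have hN := integrable_fpNumI hv hc h0 fS fA D C
  have hD := integrable_fpDen hv hc h0
  have hΦ := integrable_fpDivFlux4 a b c n hv hc h0
  have h1 : ∫ x, fpNumI fS fA D C x (v x) (fpGrad v x) =
      ∫ x, (fpNumI fS fA D C x (v x) (fpGrad v x) + fpDivFlux4 a b c n x (v x) (fpGrad v x)) := by
    rw [integral_add hN hΦ, integral_fpDivFlux4_eq_zero a b c n hv hc h0, add_zero]
  have h2 : ∫ x, (fpNumI fS fA D C x (v x) (fpGrad v x) + fpDivFlux4 a b c n x (v x) (fpGrad v x)) ≤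
      ∫ x, t * fpDen x (fpGrad v x) :=
    integral_mono (hN.add hΦ) (hD.const_mul _) fun x => farPencil4_pointwise_le' hcert x (v x) (fpGrad v x)
  rw [h1]
  exact h2.trans_eq (integral_const_mul _ _)

/-- **Instance: certificate D for test fields** — `∫ N(7/4,7/4,6/5,9/10) ≤ (9/40)·∫ Den` along every compactly supported `C²` field
vanishing near the reference site.  NOT a proof of H12⋆, NOT summit progress. -/
theorem farPencilD_integral_le (hv : ContDiff ℝ 2 v) (hc : HasCompactSupport v) (h0 : (0 : Fin 3 → ℝ) ∉ tsupport v) :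
    ∫ x, fpNumI (7 / 4) (7 / 4) (6 / 5) (9 / 10) x (v x) (fpGrad v x) ≤ 9 / 40 * ∫ x, fpDen x (fpGrad v x) :=
  farPencil4_integral_le farPencilCert_D hv hc h0

/-- The same with the hypothesis `v = 0` near `0` phrased as an eventual equality. -/
theorem farPencil4_integral_le_of_eventuallyEq {fS fA D C a b c n t : ℝ}
    (hcert : ∀ (x v : Fin 3 → ℝ) (G : Fin 3 → Fin 3 → ℝ), x ≠ 0 → fpNumI fS fA D C x v G + fpDivFlux4 a b c n x v G ≤ t * fpDen x G)
    (hv : ContDiff ℝ 2 v) (hc : HasCompactSupport v) (h0 : v =ᶠ[𝓝 0] 0) :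
    ∫ x, fpNumI fS fA D C x (v x) (fpGrad v x) ≤ t * ∫ x, fpDen x (fpGrad v x) :=
  farPencil4_integral_le hcert hv hc (notMem_tsupport_iff_eventuallyEq.2 h0)

end Summit.AtomisticToContinuum.Crystallization.Theorems.StrictSplittingRuleBirth
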